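import Summits.ABC.ABC.Theorems.IneffectiveSubspaceDepthCountedABCStubQuarticThueWindow

/-!
# Stub `stub_quarticThueSharp` of line `Sketch` — crux `IneffectiveSubspace.DepthCountedABC` (stmt-ABC-14938)

THE WINDOW OF THE CELL-0 SUB-CRUX IS SHARP AT `η = 2` (lead c22, certificate Stub 21).  `…StubQuarticThueWindow` (Stub 18) proved
`ABC ⟹ UniformQuarticThue η` for `η < 8/5` (bookkeeping `c ≥ Z⁴`) and `¬ UniformQuarticThue η` for `η > 2`.  Keeping the
cofactor `v` in `c = v·Z⁴` closes the gap: from `Y⁴ ≤ uY⁴ < vZ⁴` one has `Y ≤ v^(1/4)·Z`, so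
`rad ≤ a·u·v·Y·Z ≤ (a·u·v)·v^(1/4)·Z²` and `rad^(1+ε) ≤ (auv)^(1+ε)·v·Z^(2+2ε)` (`v^((1+ε)/4) ≤ v`), whence
`v·Z⁴ = c < C·rad^(1+ε) ≤ v·C·Z^(η(1+ε)+2+2ε)`; cancelling `v` and choosing `ε = (2−η)/(2(2+η))` gives `Z^((2−η)/2) < C`.
So `ABC ⟹ UniformQuarticThue η` for EVERY `0 < η < 2`, and with Stub 18 the sub-crux is decided by `ABC` exactly on `(0, 2)` and
refuted unconditionally on `(2, ∞)` — matching the heuristic threshold (`Σ_{u,v} u^(−5/4)v^(−7/4) < ∞`).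

Sources: skeleton `Cruxes/DepthCountedABC/Lines/Sketch.lean` (c22, Stub 21 `stub_quarticThueSharp`); imports Stub 18's file for
`quarticThue_triple` (the abc triple `(a, uY⁴, vZ⁴)` with `rad ≤ a·u·v·Y·Z`) and `nat_le_floor_of_lt`; Mathlib otherwise.
-/

-- `Summit.<Summit>.<Problem>` is the mandated summit-side namespace (CONVENTIONS §2); for the
-- single-conjunct summit `ABC` the two coincide, so the duplicate `ABC.ABC` is deliberate.
set_option linter.dupNamespace false

namespace Summit.ABC.ABC.Theorems.DepthCountedABC

open Literature.NumberTheory.DiophantineGeometry (IsABCTriple rad rad_def)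

/-- **Stub `stub_quarticThueSharp` (certificate Stub 21, lead c22) of line `Sketch`, crux `DepthCountedABC` (stmt-ABC-14938):**
`ABC ⟹ UniformQuarticThue η` for every `0 < η < 2` (sharp: Stub 18 refutes every `η > 2`). [folklore reduction] -/
theorem stub_quarticThueSharp : _root_.ABC → ∀ η : ℝ, 0 < η → η < 2 →
    ∃ B : ℕ, ∀ a u v Y Z : ℕ, 0 < a → 0 < u → 0 < v → 0 < Y → 0 < Z →
      a + u * Y ^ 4 = v * Z ^ 4 → Nat.Coprime (u * Y ^ 4) (v * Z ^ 4) →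
      ((a * u * v : ℕ) : ℝ) ≤ (Z : ℝ) ^ η → Z ≤ B := by
  intro habc η hη hη2
  set ε : ℝ := (2 - η) / (2 * (2 + η)) with hε
  have hεpos : 0 < ε := by rw [hε]; exact div_pos (by linarith) (by linarith)
  have hε1 : ε ≤ 3 := by
    rw [hε, div_le_iff₀ (by linarith)]; nlinarith
  set κ : ℝ := (2 - η) / 2 with hκ
  have hκpos : 0 < κ := by rw [hκ]; linarith
  have hexp : η * (1 + ε) + (2 + 2 * ε) = 4 - κ := by
    rw [hε, hκ]; field_simp; ring
  obtain ⟨C, hCpos, hC⟩ := (ABC_iff.mp habc) ε hεpos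
  refine ⟨⌊C ^ (1 / κ)⌋₊, ?_⟩
  intro a u v Y Z ha hu hv hY hZ hsum hcop hauv
  obtain ⟨habc3, hRle⟩ := quarticThue_triple ha hu hv hY hZ hsum hcop
  have hlt := hC a (u * Y ^ 4) (v * Z ^ 4) habc3
  set R : ℕ := rad a (u * Y ^ 4) (v * Z ^ 4) with hR
  have hZ1 : (1 : ℝ) ≤ (Z : ℝ) := by exact_mod_cast hZ
  have hZ0 : (0 : ℝ) < (Z : ℝ) := by linarith
  have hY0 : (0 : ℝ) ≤ (Y : ℝ) := by positivity
  have hv1 : (1 : ℝ) ≤ (v : ℝ) := by exact_mod_cast hv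
  have hv0 : (0 : ℝ) < (v : ℝ) := by linarith
  -- `Y⁴ < v·Z⁴`, hence `Y ≤ v^(1/4)·Z`
  have hY4nat : Y ^ 4 < v * Z ^ 4 := by
    have h1 : Y ^ 4 ≤ u * Y ^ 4 := Nat.le_mul_of_pos_left _ hu
    omega
  have hY4 : (Y : ℝ) ^ (4 : ℕ) ≤ (v : ℝ) * (Z : ℝ) ^ (4 : ℕ) := by exact_mod_cast hY4nat.le
  have hYle : (Y : ℝ) ≤ (v : ℝ) ^ ((1 : ℝ) / 4) * (Z : ℝ) := by
    have h1 : ((Y : ℝ) ^ (4 : ℕ)) ^ ((1 : ℝ) / 4) ≤ ((v : ℝ) * (Z : ℝ) ^ (4 : ℕ)) ^ ((1 : ℝ) / 4) :=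
      Real.rpow_le_rpow (by positivity) hY4 (by norm_num)
    have h2 : ((Y : ℝ) ^ (4 : ℕ)) ^ ((1 : ℝ) / 4) = (Y : ℝ) := by
      rw [← Real.rpow_natCast, ← Real.rpow_mul hY0]; norm_num
    have h3 : ((v : ℝ) * (Z : ℝ) ^ (4 : ℕ)) ^ ((1 : ℝ) / 4) = (v : ℝ) ^ ((1 : ℝ) / 4) * (Z : ℝ) := by
      rw [Real.mul_rpow hv0.le (by positivity), ← Real.rpow_natCast (Z : ℝ) 4, ← Real.rpow_mul hZ0.le]; norm_num
    rw [h2, h3] at h1; exact h1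
  -- `R ≤ (a u v)·v^(1/4)·Z²`
  have hauv' : (a : ℝ) * u * v ≤ (Z : ℝ) ^ η := by exact_mod_cast hauv
  have hauv0 : (0 : ℝ) ≤ (a : ℝ) * u * v := by positivity
  have hRreal : (R : ℝ) ≤ ((a : ℝ) * u * v) * ((v : ℝ) ^ ((1 : ℝ) / 4) * (Z : ℝ)) * (Z : ℝ) := by
    have h1 : (R : ℝ) ≤ ((a : ℝ) * u * v) * Y * Z := by exact_mod_cast hRle
    have h2 : ((a : ℝ) * u * v) * Y * Z ≤ ((a : ℝ) * u * v) * ((v : ℝ) ^ ((1 : ℝ) / 4) * (Z : ℝ)) * (Z : ℝ) :=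
      mul_le_mul_of_nonneg_right (mul_le_mul_of_nonneg_left hYle hauv0) hZ0.le
    exact h1.trans h2
  -- `R^(1+ε) ≤ v · Z^(η(1+ε) + 2 + 2ε) = v · Z^(4−κ)`
  have hR0 : (0 : ℝ) ≤ (R : ℝ) := by positivity
  have h1ε : (0 : ℝ) ≤ 1 + ε := by linarith
  have hvpow : ((v : ℝ) ^ ((1 : ℝ) / 4)) ^ (1 + ε) ≤ (v : ℝ) := by
    rw [← Real.rpow_mul hv0.le]
    calc (v : ℝ) ^ ((1 : ℝ) / 4 * (1 + ε)) ≤ (v : ℝ) ^ (1 : ℝ) :=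
          Real.rpow_le_rpow_of_exponent_le hv1 (by nlinarith)
      _ = (v : ℝ) := Real.rpow_one _
  have hZpow : ((Z : ℝ) * (Z : ℝ)) ^ (1 + ε) = (Z : ℝ) ^ (2 + 2 * ε) := by
    rw [show (Z : ℝ) * (Z : ℝ) = (Z : ℝ) ^ (2 : ℕ) by ring, ← Real.rpow_natCast, ← Real.rpow_mul hZ0.le]
    congr 1; push_cast; ring
  have hRpow : (R : ℝ) ^ (1 + ε) ≤ (v : ℝ) * (Z : ℝ) ^ (4 - κ) := by
    have h1 : (R : ℝ) ^ (1 + ε) ≤ (((a : ℝ) * u * v) * ((v : ℝ) ^ ((1 : ℝ) / 4) * (Z : ℝ)) * (Z : ℝ)) ^ (1 + ε) :=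
      Real.rpow_le_rpow hR0 hRreal h1ε
    have h2 : (((a : ℝ) * u * v) * ((v : ℝ) ^ ((1 : ℝ) / 4) * (Z : ℝ)) * (Z : ℝ)) ^ (1 + ε) =
        ((a : ℝ) * u * v) ^ (1 + ε) * ((v : ℝ) ^ ((1 : ℝ) / 4)) ^ (1 + ε) * ((Z : ℝ) * (Z : ℝ)) ^ (1 + ε) := by
      rw [show ((a : ℝ) * u * v) * ((v : ℝ) ^ ((1 : ℝ) / 4) * (Z : ℝ)) * (Z : ℝ) =
          (((a : ℝ) * u * v) * (v : ℝ) ^ ((1 : ℝ) / 4)) * ((Z : ℝ) * (Z : ℝ)) by ring,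
        Real.mul_rpow (by positivity) (by positivity), Real.mul_rpow hauv0 (by positivity)]
    have h3 : ((a : ℝ) * u * v) ^ (1 + ε) ≤ ((Z : ℝ) ^ η) ^ (1 + ε) := Real.rpow_le_rpow hauv0 hauv' h1ε
    have h4 : ((Z : ℝ) ^ η) ^ (1 + ε) = (Z : ℝ) ^ (η * (1 + ε)) := by rw [← Real.rpow_mul hZ0.le]
    have h5 : (Z : ℝ) ^ (η * (1 + ε)) * (Z : ℝ) ^ (2 + 2 * ε) = (Z : ℝ) ^ (4 - κ) := by
      rw [← Real.rpow_add hZ0, hexp]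
    calc (R : ℝ) ^ (1 + ε)
        ≤ ((a : ℝ) * u * v) ^ (1 + ε) * ((v : ℝ) ^ ((1 : ℝ) / 4)) ^ (1 + ε) * ((Z : ℝ) * (Z : ℝ)) ^ (1 + ε) := by
          rw [← h2]; exact h1
      _ ≤ (Z : ℝ) ^ (η * (1 + ε)) * (v : ℝ) * (Z : ℝ) ^ (2 + 2 * ε) := by
          rw [hZpow, ← h4]
          apply mul_le_mul_of_nonneg_right _ (by positivity)
          exact mul_le_mul h3 hvpow (by positivity) (by positivity)
      _ = (v : ℝ) * (Z : ℝ) ^ (4 - κ) := by rw [← h5]; ring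
  -- `v·Z⁴ = c < C·R^(1+ε) ≤ v·C·Z^(4−κ)`, cancel `v`
  have hcZ : (v : ℝ) * (Z : ℝ) ^ (4 : ℕ) = ((v * Z ^ 4 : ℕ) : ℝ) := by push_cast; ring
  have hZ4lt : (v : ℝ) * (Z : ℝ) ^ (4 : ℕ) < (v : ℝ) * (C * (Z : ℝ) ^ (4 - κ)) :=
    calc (v : ℝ) * (Z : ℝ) ^ (4 : ℕ) = ((v * Z ^ 4 : ℕ) : ℝ) := hcZ
      _ < C * ((rad a (u * Y ^ 4) (v * Z ^ 4) : ℕ) : ℝ) ^ (1 + ε) := hlt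
      _ = C * (R : ℝ) ^ (1 + ε) := by rw [hR]
      _ ≤ C * ((v : ℝ) * (Z : ℝ) ^ (4 - κ)) := mul_le_mul_of_nonneg_left hRpow hCpos.le
      _ = (v : ℝ) * (C * (Z : ℝ) ^ (4 - κ)) := by ring
  have hZ4lt' : (Z : ℝ) ^ (4 : ℕ) < C * (Z : ℝ) ^ (4 - κ) := lt_of_mul_lt_mul_left hZ4lt hv0.le
  have hsplit : (Z : ℝ) ^ (4 : ℕ) = (Z : ℝ) ^ κ * (Z : ℝ) ^ (4 - κ) := by
    rw [← Real.rpow_add hZ0, ← Real.rpow_natCast (Z : ℝ) 4]; congr 1; push_cast; ring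
  have hZκ : (Z : ℝ) ^ κ < C := by
    rw [hsplit] at hZ4lt'
    exact lt_of_mul_lt_mul_right hZ4lt' (Real.rpow_nonneg hZ0.le _)
  have hZlt : (Z : ℝ) < C ^ (1 / κ) := by
    have h1 : ((Z : ℝ) ^ κ) ^ (1 / κ) < C ^ (1 / κ) :=
      Real.rpow_lt_rpow (Real.rpow_nonneg hZ0.le _) hZκ (by positivity)
    have h2 : ((Z : ℝ) ^ κ) ^ (1 / κ) = (Z : ℝ) := by
      rw [← Real.rpow_mul hZ0.le, mul_one_div_cancel hκpos.ne', Real.rpow_one]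
    rw [h2] at h1; exact h1
  exact nat_le_floor_of_lt hZlt

end Summit.ABC.ABC.Theorems.DepthCountedABC
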